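import Summits.BirchSwinnertonDyer.BirchSwinnertonDyer.Theorems.RamifiedHeegnerPairTwistUnitSaving
import HarnessLib

/-!
# U₀ at the SAVING ROWS of the Gss2 census (rank zero), TU₀|saving — part C: `78660s1`, `84150gr1`

Continuation of `…Theorems.RamifiedHeegnerPairTwistUnitSaving` (seat `bsd-trib-w-rhp` g15; doors, framing and data provenance there; generic kernel lemmas g14's `…TwistUnitInert`):
per rank zero curve `subGss_three_/Δ_eq_/c₄_eq_/krausList_/surj_three_<label>` IN THE KERNEL, Kraus minimality of `V = E^{(-3)}_min` and of the twist model `Wd`, and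
`u0s_at_<label> : … → MissingUpperBoundAt W 3` by p674548 `LeafShimuraInert.leafRankZeroUpper_three_of_shimuraInertDatum_at_saving_of_twistUnitZero` through
`leafRankZeroUpper_three_at_saving_of_sqrtField` — printed facts `hGZK hmod hnf hJL hCO hPrim` as hypotheses; `q₁ ∣ Δ_min`, multiplicative / no-split / Tate certificates, `hFC`, `hshape` off `q₁`, (DEG), field
congruences IN THE KERNEL; `hN hr Dt hc` + `L(E^D,1) = 0 ≠ L′(E^D,1)` + `#Ш(Wd)_an` DISPLAYED.  **HONEST FRAMING: theorems only; nothing booked, no item closed; U₀ (26024) / TU|saving / the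
Shimura-curve Heegner-system inputs stay research-level and OPEN class-wide; BSD is NOT proved for any curve by this file.**
[cite: JetchevSkinnerWan2017, §7.4.2 (p. 31)] [cite: PastenShimura2024, Prop. 6.13, Lemma 6.15, Lemma 6.18] [cite: Serre1972, §2.8] [cite: Kraus1989, Prop. 1] [cite: Cremona2006, Table 1]
-/

set_option linter.dupNamespace false
set_option autoImplicit false

noncomputable section

open scoped Classical NumberField

open WeierstrassCurve NumberField IsDedekindDomain IsDedekindDomain.HeightOneSpectrum Rat.HeightOneSpectrum Field Literature Literature.NumberTheory.DiophantineGeometry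
  Literature.NumberTheory.EllipticCurves Literature.NumberTheory.EllipticCurves.ModularForms Literature.NumberTheory.EllipticCurves.Rank1Residual
  Literature.NumberTheory.EllipticCurves.Rank1Residual.Typed Literature.NumberTheory.Automorphic Literature.NumberTheory.EllipticCurves.Rank1Residual.X11RankOneCertificates
  Literature.NumberTheory.EllipticCurves.KrizLi2019 Literature.NumberTheory.GaloisRepresentations Literature.NumberTheory.QuadraticFields Literature.NumberTheory.QuadraticFields.Quadratic
  Summit.BirchSwinnertonDyer.BirchSwinnertonDyer.Rank1Residual Summit.BirchSwinnertonDyer.BirchSwinnertonDyer.Rank1Residual.IntModel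
  Summit.BirchSwinnertonDyer.BirchSwinnertonDyer.Rank2Observatory.Tam Summit.BirchSwinnertonDyer.Rank1Residual Summit.BirchSwinnertonDyer.Rank1Residual.Additive
  Summit.BirchSwinnertonDyer.Rank1Residual.X11b Summit.BirchSwinnertonDyer.Rank1Residual.X11b.Three Summit.BirchSwinnertonDyer.Rank1Residual.X9 Summit.BirchSwinnertonDyer.Rank1Residual.GaloisImage
  Summit.BirchSwinnertonDyer.Rank1Residual.Supersingular Summit.BirchSwinnertonDyer.BirchSwinnertonDyer.Theses.RamifiedHeegnerPair Summit.BirchSwinnertonDyer.BirchSwinnertonDyer.Theorems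
  Summit.BirchSwinnertonDyer.BirchSwinnertonDyer.Theorems.SchneiderFree Summit.BirchSwinnertonDyer.BirchSwinnertonDyer.Theorems.RamifiedPairUpperBound
  Summit.BirchSwinnertonDyer.BirchSwinnertonDyer.Theorems.RamifiedHeegnerPairStepLIntrinsic Summit.BirchSwinnertonDyer.BirchSwinnertonDyer.Theorems.AdditiveBranchIMCGordTwoRankOne.HeegnerKolyvagin
  Summit.BirchSwinnertonDyer.BirchSwinnertonDyer.Theorems.RamifiedHeegnerPairTwistUnitIntrinsic Summit.BirchSwinnertonDyer.BirchSwinnertonDyer.Theorems.RamifiedHeegnerPairTwistUnitAdditive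
  Summit.BirchSwinnertonDyer.BirchSwinnertonDyer.Theorems.RamifiedHeegnerPairTwistUnitInert

namespace Summit.BirchSwinnertonDyer.BirchSwinnertonDyer.Theorems.RamifiedHeegnerPairTwistUnitSaving

open RamifiedHeegnerPairTwistUnitInert

/-! ## §3 `78660s1` = `[0, 0, 0, -7767, -264114]`, `N = 78660 = 2^2·3^2·5·19·23` (`2`: IV*, `c = 3`, `3`: I₀*, `c = 2`, `5`: I1, `c = 1`, split, `19`: I3, `c = 3`, split, `23`: I1, `c = 1`, split); exempted carrier `q₁ = 2` (additive IV*, `c = 3`), inert set `S = {5, 19}` (multiplicative), (DEG) très ramifié at `s₁ = 5` (`3 ∤ ord_{5} Δ = 1`);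
`ρ̄₃` onto (certificate primes `ℓ₁ = 13`, `#Ẽ(𝔽_{13}) = 11`; `ℓ₂ = 7`, `#Ẽ(𝔽_{7}) = 6`); `r_an = 0`, `#E(ℚ)_tors = 1`, `∏ c_ℓ = 18`, `#Ш(E)_an = 1` (Cremona/LMFDB, displayed where used); class `78660s` of size 1.
`V = E^{(-3)}_min = [0, 0, 0, -863, 9782]` (`#Ṽ(𝔽₃) = 4`).  JSW field `K = ℚ(√-263)` (`263` prime; `5`, `19` inert, every other `ℓ ∣ N` split): the least such `D` (among those tried) with a CERTIFIED twist unit (kit j322551: root no. `−1`, `L′(Wd,1) = 13.032552`, `Wd = E^{(-263)}_min = [0, 0, 0, -537235623, 4804615832958]`, `N(Wd) = 5440833540`, `∏c = 12`, `T = 1`, point by `ellrank(effort=0)`, eclib-full saturation (index 1), `ĥ = 17.038552`,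
`X = L′T²/(Ω∏c ĥ) = 1` to `0e+00` — the numerical `#Ш(Wd)_an` given rank `1`). -/

/-- `V = [0, 0, 0, -863, 9782]` (the minimal model of `78660s1^{(-3)}`, conductor `8740`): `Δ ≠ 0` in the kernel. [cite: Cremona2006, Table 1 (Cremona label 78660s1)] -/
theorem isElliptic_sV78660s1 : (⟨0, 0, 0, -863, 9782⟩ : WeierstrassCurve ℚ).IsElliptic :=
  isElliptic_of_discOf_ne_zero 0 0 0 (-863) 9782 (by decide +kernel)

/-- `V` is globally minimal: `|Δ| = 2^8·5·19^3·23` kernel-checked, Kraus' criterion prime by prime. [cite: Kraus1989, Prop. 1 and Prop. 2]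
[cite: SilvermanAEC2009, VII.1 Remark 1.1] [cite: Cremona2006, Table 1 (Cremona label 78660s1)] -/
theorem isGloballyMinimal_sV78660s1 : (⟨0, 0, 0, -863, 9782⟩ : WeierstrassCurve ℚ).IsGloballyMinimal :=
  isGloballyMinimal_of_krausCriterion₃_factored 0 0 0 (-863) 9782
    [(2, 8), (5, 1), (19, 3), (23, 1)] (by decide +kernel)
    (by intro qe hqe; simp only [List.mem_cons, List.not_mem_nil, or_false] at hqe
        rcases hqe with rfl | rfl | rfl | rfl <;> norm_num)
    (by set_option synthInstance.maxSize 2000 in decide +kernel)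

/-- `Wd = [0, 0, 0, -537235623, 4804615832958]` (the minimal model of the twist `78660s1^{(-263)}`, conductor `5440833540`): `Δ ≠ 0` in the kernel. [cite: Cremona2006, Table 1 (Cremona label 78660s1)] -/
theorem isElliptic_sWd78660s1 : (⟨0, 0, 0, -537235623, 4804615832958⟩ : WeierstrassCurve ℚ).IsElliptic :=
  isElliptic_of_discOf_ne_zero 0 0 0 (-537235623) 4804615832958 (by decide +kernel)

/-- `Wd` is globally minimal: `|Δ| = 2^8·3^6·5·19^3·23·263^6` kernel-checked, Kraus' criterion prime by prime. [cite: Kraus1989, Prop. 1 and Prop. 2]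
[cite: SilvermanAEC2009, VII.1 Remark 1.1] [cite: Cremona2006, Table 1 (Cremona label 78660s1)] -/
theorem isGloballyMinimal_sWd78660s1 : (⟨0, 0, 0, -537235623, 4804615832958⟩ : WeierstrassCurve ℚ).IsGloballyMinimal :=
  isGloballyMinimal_of_krausCriterion₃_factored 0 0 0 (-537235623) 4804615832958
    [(2, 8), (3, 6), (5, 1), (19, 3), (23, 1), (263, 6)] (by decide +kernel)
    (by intro qe hqe; simp only [List.mem_cons, List.not_mem_nil, or_false] at hqe
        rcases hqe with rfl | rfl | rfl | rfl | rfl | rfl <;> norm_num)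
    (by set_option synthInstance.maxSize 2000 in decide +kernel)

/-- **`78660s1` is ADDITIVE at `3` and on the cell (G) ∧ ss, IN THE KERNEL**: `3 ∣ Δ`, `3 ∣ c₄`; `C • V^{(-3)} = E` (`[u, r, s, t] = [1, 0, 0, 0]`) with
`V` globally minimal, `3 ∤ Δ(V)`, `#Ṽ(𝔽₃) = 4` (`a₃(V) = 0`, supersingular), whence `TypeG`, `SubGord`, `SubGss` at `3` (g13's block, unchanged).
[cite: SilvermanAEC2009, VII.5 Prop. 5.1 (a), (c)] [cite: Delbourgo1998, §1.5 (G)] [cite: Cremona2006, Table 1 (Cremona label 78660s1)] -/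
theorem subGss_three_78660s1 {W : WeierstrassCurve ℚ} [W.IsElliptic] [W.IsGloballyMinimal] (hWeq : W = (⟨0, 0, 0, -7767, -264114⟩ : WeierstrassCurve ℚ)) :
    Addv W 3 ∧ SubGss W 3 := by
  subst hWeq
  haveI := isElliptic_sV78660s1
  haveI := isGloballyMinimal_sV78660s1
  have hIW : integralModelInt (⟨0, 0, 0, -7767, -264114⟩ : WeierstrassCurve ℚ) = (⟨0, 0, 0, -7767, -264114⟩ : WeierstrassCurve ℤ) :=
    integralModelInt_eq_of_map_eq _ (map_mk_int 0 0 0 (-7767) (-264114))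
  have hadd : Addv (⟨0, 0, 0, -7767, -264114⟩ : WeierstrassCurve ℚ) 3 := Additive.addv_of_intModel hIW 3 (by decide +kernel) (by decide +kernel)
  have hIV : integralModelInt (⟨0, 0, 0, -863, 9782⟩ : WeierstrassCurve ℚ) = (⟨0, 0, 0, -863, 9782⟩ : WeierstrassCurve ℤ) :=
    integralModelInt_eq_of_map_eq _ (map_mk_int 0 0 0 (-863) 9782)
  have hcV : Nat.card ((((⟨0, 0, 0, -863, 9782⟩ : WeierstrassCurve ℤ)).map (Int.castRingHom (ZMod 3))).toAffine.Point) = 4 := by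
    have h := natCard_point_eq_countPoints 0 0 0 (-863) 9782 3 (by norm_num) (by decide +kernel)
    have h' : countPoints [0, 0, 0, -863, 9782] 3 = 4 := countPoints_eq_of_fast (by decide +kernel)
    exact_mod_cast h.trans h'
  have hgood : GoodSS (⟨0, 0, 0, -863, 9782⟩ : WeierstrassCurve ℚ) 3 := Supersingular.goodSS_of_intModel 3 hIV (by decide +kernel) hcV (by decide)
  have hVW : (⟨1, (0 : ℚ), (0 : ℚ), (0 : ℚ)⟩ : VariableChange ℚ) • (⟨0, 0, 0, -863, 9782⟩ : WeierstrassCurve ℚ).quadraticTwist (-3) =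
      (⟨0, 0, 0, -7767, -264114⟩ : WeierstrassCurve ℚ) := by
    ext <;> simp [WeierstrassCurve.variableChange_a₁, WeierstrassCurve.variableChange_a₂,
      WeierstrassCurve.variableChange_a₃, WeierstrassCurve.variableChange_a₄, WeierstrassCurve.variableChange_a₆,
      WeierstrassCurve.quadraticTwist, WeierstrassCurve.b₂, WeierstrassCurve.b₄, WeierstrassCurve.b₆] <;> norm_num
  obtain ⟨C, hC⟩ := exists_variableChange_quadraticTwist_symm (⟨0, 0, 0, -7767, -264114⟩ : WeierstrassCurve ℚ)
    (⟨0, 0, 0, -863, 9782⟩ : WeierstrassCurve ℚ) (d := (-3 : ℚ)) (by norm_num) ⟨_, hVW⟩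
  have hC' : C • (⟨0, 0, 0, -7767, -264114⟩ : WeierstrassCurve ℚ).quadraticTwist ((-1 : ℚ) ^ ((3 : ℕ) / 2) * (3 : ℕ)) =
      (⟨0, 0, 0, -863, 9782⟩ : WeierstrassCurve ℚ) := by
    rw [O5.pstar_three]; exact hC
  have hG : TypeG (⟨0, 0, 0, -7767, -264114⟩ : WeierstrassCurve ℚ) 3 := (typeG_three_iff_good_twist _ hadd _ C hC').mpr hgood.1
  exact ⟨hadd, (O5.subGss_three_iff_subGord_and_goodSS_twist _ hadd _ C hC).mpr
    ⟨subGord_three_of_typeG_of_addv _ hG hadd, hgood⟩⟩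

/-- `Δ(E₀) = -147206211840 = -2^8·3^6·5·19^3·23` on the integer equation of `78660s1`. [cite: Cremona2006, Table 1 (Cremona label 78660s1)] -/
theorem Δ_eq_78660s1 : (⟨0, 0, 0, -7767, -264114⟩ : WeierstrassCurve ℤ).Δ = -147206211840 := by
  norm_num [WeierstrassCurve.Δ, WeierstrassCurve.b₂, WeierstrassCurve.b₄, WeierstrassCurve.b₆, WeierstrassCurve.b₈]

/-- `c₄(E₀) = 372816` on the integer equation of `78660s1`. [cite: Cremona2006, Table 1 (Cremona label 78660s1)] -/
theorem c₄_eq_78660s1 : (⟨0, 0, 0, -7767, -264114⟩ : WeierstrassCurve ℤ).c₄ = 372816 := by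
  norm_num [WeierstrassCurve.c₄, WeierstrassCurve.b₂, WeierstrassCurve.b₄]

/-- The Kraus list of `78660s1` consists of primes and multiplies to `|Δ(E₀)|`, IN THE KERNEL: a prime dividing `Δ_min` is one of `[2, 3, 5, 19, 23]`. [cite: Cremona2006, Table 1 (Cremona label 78660s1)] -/
theorem krausList_78660s1 : (∀ qe ∈ ([(2, 8), (3, 6), (5, 1), (19, 3), (23, 1)] : List (ℕ × ℕ)), qe.1.Prime) ∧
    (([(2, 8), (3, 6), (5, 1), (19, 3), (23, 1)] : List (ℕ × ℕ)).map fun qe => qe.1 ^ qe.2).prod = (-147206211840 : ℤ).natAbs :=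
  ⟨by decide +kernel, by decide +kernel⟩

/-- **`ρ̄_{E,3}` ONTO for `78660s1`, IN THE KERNEL** (Frobenius-order witness `hasSurjectiveModNGaloisRep_of_intModel_of_irr_of_order`): at the good prime `ℓ₁ = 13` (`#Ẽ(𝔽_{13}) = 11`,
`a = 3`) `X² − aX + 13` is irreducible mod `3`; at `ℓ₂ = 7 ≡ 1 (mod 3)` (`#Ẽ = 6`, `a = 2 ≡ 2`, `9 ∤ 6`) an element of order `3`; point counts by `countPoints_eq_of_fast`
(Sage's `is_surjective(3)` agrees). [cite: Serre1972, §2.8 Prop. 19] [cite: Zywina2015, §1] [cite: Cremona2006, Table 1 (Cremona label 78660s1)] -/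
theorem surj_three_78660s1 {W : WeierstrassCurve ℚ} [W.IsElliptic] [W.IsGloballyMinimal] (hWeq : W = (⟨0, 0, 0, -7767, -264114⟩ : WeierstrassCurve ℚ)) : Surj W 3 := by
  subst hWeq
  haveI : Fact (Nat.Prime 13) := ⟨by norm_num⟩
  haveI : Fact (Nat.Prime 7) := ⟨by norm_num⟩
  have hI : integralModelInt (⟨0, 0, 0, -7767, -264114⟩ : WeierstrassCurve ℚ) = (⟨0, 0, 0, -7767, -264114⟩ : WeierstrassCurve ℤ) :=
    integralModelInt_eq_of_map_eq _ (map_mk_int 0 0 0 (-7767) (-264114))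
  have hc₁ : Nat.card ((((⟨0, 0, 0, -7767, -264114⟩ : WeierstrassCurve ℤ)).map (Int.castRingHom (ZMod 13))).toAffine.Point) = 11 := by
    exact_mod_cast (natCard_point_eq_countPoints 0 0 0 (-7767) (-264114) 13 (by norm_num) (by decide +kernel)).trans (countPoints_eq_of_fast (n := 11) (by decide +kernel))
  have hc₂ : Nat.card ((((⟨0, 0, 0, -7767, -264114⟩ : WeierstrassCurve ℤ)).map (Int.castRingHom (ZMod 7))).toAffine.Point) = 6 := by
    exact_mod_cast (natCard_point_eq_countPoints 0 0 0 (-7767) (-264114) 7 (by norm_num) (by decide +kernel)).trans (countPoints_eq_of_fast (n := 6) (by decide +kernel))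
  exact hasSurjectiveModNGaloisRep_of_intModel_of_irr_of_order hI 3 13 7 (by norm_num) (by norm_num) (by rw [Δ_eq_78660s1]; norm_num)
    (by rw [Δ_eq_78660s1]; norm_num) hc₁ hc₂ (by decide) (by decide) (by decide) (by decide)

/-- **U₀ AT `78660s1` ON ITS SAVING ROW (inert-set Shimura-curve road, TU₀|saving)** — `MissingUpperBoundAt W 3` at `W = E` (`r_an = 0`) from rhp-p2 g11's shape
p674548 `leafRankZeroUpper_three_of_shimuraInertDatum_at_saving_of_twistUnitZero` through the door `leafRankZeroUpper_three_at_saving_of_sqrtField`.  PRINTED: `hGZK hmod hnf hJL hCO hPrim`.  KERNEL: `Addv ∧ SubGss` at `3`; `ρ̄₃` onto;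
`q₁ = 2 ∣ Δ_min`; `5`, `19` multiplicative; every prime of `Δ_min` enumerated (`krausList_78660s1`) for `hFC` and for `hshape` off `q₁` (`c = 1` off `Δ_min`, Kodaira–Néron at multiplicative
primes, Tate certificates at the additive primes `[3]`); (DEG) très ramifié at `s₁ = 5`; the congruences making `5`, `19` inert and the other `ℓ ∣ N` split in
`ℚ(√-263)`; `Cd • E^{(-263)} = Wd`, `Cd = [1, 0, 0, 0]`, `Wd` Kraus-minimal.  DISPLAYED: `hN`, `hr` (`r_an = 0`), `Dt`/`hc`, `hLt0`/`hLt1` (`L(E^{(-263)},1) = 0 ≠ L′`; census: root no. `−1`,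
`L′(Wd,1) ≈ 13.03255`), `hqd`/`hvd` (`#Ш(Wd)_an = 1`; census: `X = L′T²/(Ω∏c ĥ) = 1` to `0e+00`, eclib-full-saturated point of height `17.0386` by `ellrank(effort=0)`, 2-descent rank `1`).
NO S2 / Σ / L₀ / L₁.  Per curve; U₀ (26024) stays OPEN class-wide; BSD is NOT proved by this.
[cite: JetchevSkinnerWan2017, §7.4.2 (p. 31)] [cite: PastenShimura2024, Prop. 6.13, Lemma 6.15, Lemma 6.18] [cite: SilvermanAEC2009, VII.5 Prop. 5.1] [cite: Cremona2006, Table 1 (Cremona label 78660s1)] -/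
theorem u0s_at_78660s1
    (hGZK : rank_eq_analyticRank_of_analyticRank_le_one) (hmod : hasEntireLFunction_rat)
    (hnf : exists_isNewformOf) (hJL : nonempty_shimuraParametrizationData)
    (hCO : PastenShimura2024_componentOrders) (hPrim : shimuraCurve_heegnerSystem_primitivesAtThree)
    {W : WeierstrassCurve ℚ} [W.IsElliptic] [W.IsGloballyMinimal] (hWeq : W = (⟨0, 0, 0, -7767, -264114⟩ : WeierstrassCurve ℚ))
    (hN : W.conductorNorm ℤ = 78660) [NeZero (W.conductorNorm ℤ)] (hr : W.analyticRank = 0)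
    (Dt : ModularParametrizationData W (W.conductorNorm ℤ)) (hc : ¬ (3 : ℤ) ∣ Dt.c)
    (hLt0 : (W.quadraticTwist (((-263 : ℤ) : ℚ))).entireLFunction 1 = 0) (hLt1 : deriv (W.quadraticTwist (((-263 : ℤ) : ℚ))).entireLFunction 1 ≠ 0)
    {qd : ℚ} (hqd : haveI := isElliptic_sWd78660s1; shaAn (⟨0, 0, 0, -537235623, 4804615832958⟩ : WeierstrassCurve ℚ) = (qd : ℂ))
    (hvd : padicValRat 3 qd ≤ 0) :
    MissingUpperBoundAt W 3 := by
  subst hWeq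
  haveI := isElliptic_sWd78660s1; haveI := isGloballyMinimal_sWd78660s1
  have hI : integralModelInt (⟨0, 0, 0, -7767, -264114⟩ : WeierstrassCurve ℚ) = (⟨0, 0, 0, -7767, -264114⟩ : WeierstrassCurve ℤ) :=
    integralModelInt_eq_of_map_eq _ (map_mk_int 0 0 0 (-7767) (-264114))
  have hGS := subGss_three_78660s1 (W := (⟨0, 0, 0, -7767, -264114⟩ : WeierstrassCurve ℚ)) rfl
  have hsurj := surj_three_78660s1 (W := (⟨0, 0, 0, -7767, -264114⟩ : WeierstrassCurve ℚ)) rfl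
  haveI : Fact ((-263 : ℤ) < 0) := ⟨by norm_num⟩; haveI : Fact (Nat.Prime 2) := ⟨by norm_num⟩
  haveI : Fact (Nat.Prime 5) := ⟨by norm_num⟩; haveI : Fact (Nat.Prime 19) := ⟨by norm_num⟩
  have hbad₁ := WeierstrassCurve.not_hasGoodReductionAtPrime_of_dvd_minimalDiscriminantInt (⟨0, 0, 0, -7767, -264114⟩ : WeierstrassCurve ℚ) 2 (by rw [IntModel.minimalDiscriminantInt_eq hI, Δ_eq_78660s1]; norm_num)
  have hm₁ : (⟨0, 0, 0, -7767, -264114⟩ : WeierstrassCurve ℚ).HasMultiplicativeReductionAtPrime 5 := IntModel.hasMultiplicativeReductionAtPrime_of_intModel hI 5 (by rw [Δ_eq_78660s1]; norm_num) (by rw [c₄_eq_78660s1]; norm_num)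
  have hm₂ : (⟨0, 0, 0, -7767, -264114⟩ : WeierstrassCurve ℚ).HasMultiplicativeReductionAtPrime 19 := IntModel.hasMultiplicativeReductionAtPrime_of_intModel hI 19 (by rw [Δ_eq_78660s1]; norm_num) (by rw [c₄_eq_78660s1]; norm_num)
  have hFC : ∀ (ℓ : ℕ) [Fact ℓ.Prime], ℓ ≠ 5 → ℓ ≠ 19 → ℓ ≠ 2 → (⟨0, 0, 0, -7767, -264114⟩ : WeierstrassCurve ℚ).HasSplitMultiplicativeReductionAtPrime ℓ →
      ¬ 3 ∣ padicValInt ℓ (⟨0, 0, 0, -7767, -264114⟩ : WeierstrassCurve ℚ).minimalDiscriminantInt := by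
    intro ℓ hℓF hne₁ hne₂ hneq hs
    have hd := dvd_minimalDiscriminantInt_of_mult _ ℓ hs.hasMultiplicativeReductionAtPrime
    rw [IntModel.minimalDiscriminantInt_eq hI, Δ_eq_78660s1] at hd
    have hmem := mem_of_prime_dvd_of_prodPow_eq _ krausList_78660s1 hℓF.out hd
    simp only [List.map_cons, List.map_nil, List.mem_cons, List.not_mem_nil, or_false] at hmem
    rcases hmem with rfl | rfl | rfl | rfl | rfl
    · exact absurd rfl hneq
    · exact absurd hs.hasMultiplicativeReductionAtPrime (X9.PrintCert.not_hasMultiplicativeReductionAtPrime_of_dvd_of_dvd hI 3 (by rw [Δ_eq_78660s1]; norm_num) (by rw [c₄_eq_78660s1]; norm_num))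
    · exact absurd rfl hne₁
    · exact absurd rfl hne₂
    · rw [IntModel.minimalDiscriminantInt_eq hI, Δ_eq_78660s1, IntModel.padicValInt_eq_of_dvd_of_not_dvd 23 (e := 1) (by norm_num) (by norm_num)]
      decide
  have hshape : ∀ (q : ℕ) [Fact q.Prime], q ≠ 2 → 3 ∣ ((⟨0, 0, 0, -7767, -264114⟩ : WeierstrassCurve ℚ).baseChange ℚ_[q]).localTamagawaNumber ℤ_[q] →
      (⟨0, 0, 0, -7767, -264114⟩ : WeierstrassCurve ℚ).HasSplitMultiplicativeReductionAtPrime q := by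
    intro q hqF hq h3
    by_cases hd : (q : ℤ) ∣ minimalDiscriminantInt (⟨0, 0, 0, -7767, -264114⟩ : WeierstrassCurve ℚ)
    swap
    · exact absurd h3 (not_three_dvd_localTamagawaNumber_of_not_dvd _ q hd)
    rw [IntModel.minimalDiscriminantInt_eq hI, Δ_eq_78660s1] at hd
    have hmem := mem_of_prime_dvd_of_prodPow_eq _ krausList_78660s1 hqF.out hd
    simp only [List.map_cons, List.map_nil, List.mem_cons, List.not_mem_nil, or_false] at hmem
    rcases hmem with rfl | rfl | rfl | rfl | rfl
    · exact absurd rfl hq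
    · have hc3 : ((⟨0, 0, 0, -7767, -264114⟩ : WeierstrassCurve ℚ).baseChange ℚ_[3]).localTamagawaNumber ℤ_[3] = 2 := -- additive `3` (I0*): Tate certificate
        (IntModelTam.localTamagawaNumber_padic_eq_of_intModel_of_tamZ hI 3 (F := ⟨3, 9, 0, 0, 0, 6, 0, 1⟩) rfl (by decide +kernel)).trans (by decide)
      rw [hc3] at h3; exact absurd h3 (by decide)
    · exact (Koly.split_and_three_dvd_of_mult_of_three_dvd_localTamagawaNumber _ 5 (IntModel.hasMultiplicativeReductionAtPrime_of_intModel hI 5 (by rw [Δ_eq_78660s1]; norm_num) (by rw [c₄_eq_78660s1]; norm_num)) h3).1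
    · exact (Koly.split_and_three_dvd_of_mult_of_three_dvd_localTamagawaNumber _ 19 (IntModel.hasMultiplicativeReductionAtPrime_of_intModel hI 19 (by rw [Δ_eq_78660s1]; norm_num) (by rw [c₄_eq_78660s1]; norm_num)) h3).1
    · exact (Koly.split_and_three_dvd_of_mult_of_three_dvd_localTamagawaNumber _ 23 (IntModel.hasMultiplicativeReductionAtPrime_of_intModel hI 23 (by rw [Δ_eq_78660s1]; norm_num) (by rw [c₄_eq_78660s1]; norm_num)) h3).1
  have hjac : ∀ ℓ : ℕ, ℓ.Prime → ℓ ∣ (⟨0, 0, 0, -7767, -264114⟩ : WeierstrassCurve ℚ).conductorNorm ℤ → ℓ ≠ 5 → ℓ ≠ 19 → ℓ ≠ 2 →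
      jacobiSym (-263) ℓ = 1 := by
    intro ℓ hℓ hℓN hne₁ hne₂ hℓ2
    rw [hN] at hℓN
    have hmem : ℓ ∈ Nat.primeFactors 78660 := Nat.mem_primeFactors.mpr ⟨hℓ, hℓN, by norm_num⟩
    rw [show Nat.primeFactors 78660 = {2, 3, 5, 19, 23} by decide +kernel] at hmem
    simp only [Finset.mem_insert, Finset.mem_singleton] at hmem
    rcases hmem with rfl | rfl | rfl | rfl | rfl
    · exact absurd rfl hℓ2
    · norm_num [jacobiSym.mod_left]
    · exact absurd rfl hne₁
    · exact absurd rfl hne₂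
    · norm_num [jacobiSym.mod_left]
  have hWd : (⟨1, (0 : ℚ), (0 : ℚ), (0 : ℚ)⟩ : VariableChange ℚ) • (⟨0, 0, 0, -7767, -264114⟩ : WeierstrassCurve ℚ).quadraticTwist (((-263 : ℤ) : ℚ)) =
      (⟨0, 0, 0, -537235623, 4804615832958⟩ : WeierstrassCurve ℚ) := by
    push_cast; ext <;> simp [WeierstrassCurve.variableChange_a₁, WeierstrassCurve.variableChange_a₂,
      WeierstrassCurve.variableChange_a₃, WeierstrassCurve.variableChange_a₄, WeierstrassCurve.variableChange_a₆,
      WeierstrassCurve.quadraticTwist, WeierstrassCurve.b₂, WeierstrassCurve.b₄, WeierstrassCurve.b₆] <;> norm_num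
  exact leafRankZeroUpper_three_at_saving_of_sqrtField hGZK hmod hnf hJL hCO hPrim _ hGS.1 hGS.2 hr hsurj rfl Dt hc 2 hbad₁
    (s₁ := 5) (s₂ := 19) (by decide) (by decide) (by decide) hm₁ hm₂ hFC hshape
    (Or.inl (by rw [IntModel.minimalDiscriminantInt_eq hI, Δ_eq_78660s1, IntModel.padicValInt_eq_of_dvd_of_not_dvd 5 (e := 1) (by norm_num) (by norm_num)]; decide))
    (-263) (by norm_num) (by rw [show (-263 : ℤ).natAbs = 263 by rfl, Nat.squarefree_iff_nodup_primeFactorsList (by norm_num)]; simp)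
    (Or.inr ⟨by decide, by norm_num [jacobiSym.mod_left]⟩) (by norm_num) (Or.inr ⟨by decide, by norm_num [jacobiSym.mod_left]⟩) (by norm_num) hjac
    (fun _ _ _ ↦ by norm_num) hLt0 hLt1 _ _ hWd hqd hvd

/-! ## §4 `84150gr1` = `[1, -1, 1, -114680, -14922053]`, `N = 84150 = 2·3^2·5^2·11·17` (`2`: I6, `c = 6`, split, `3`: I₀*, `c = 1`, `5`: IV*, `c = 3`, `11`: I2, `c = 2`, non-split, `17`: I1, `c = 1`, non-split); exempted carrier `q₁ = 5` (additive IV*, `c = 3`), inert set `S = {11, 2}` (multiplicative), (DEG) très ramifié at `s₁ = 11` (`3 ∤ ord_{11} Δ = 2`);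
`ρ̄₃` onto (certificate primes `ℓ₁ = 23`, `#Ẽ(𝔽_{23}) = 32`; `ℓ₂ = 7`, `#Ẽ(𝔽_{7}) = 3`); `r_an = 0`, `#E(ℚ)_tors = 1`, `∏ c_ℓ = 36`, `#Ш(E)_an = 1` (Cremona/LMFDB, displayed where used); class `84150gr` of size 1.
`V = E^{(-3)}_min = [1, -1, 0, -12742, 556916]` (`#Ṽ(𝔽₃) = 1`).  JSW field `K = ℚ(√-59)` (`59` prime; `11`, `2` inert, every other `ℓ ∣ N` split): the least such `D` (among those tried) with a CERTIFIED twist unit (kit j322551: root no. `−1`, `L′(Wd,1) = 18.314857`, `Wd = E^{(-59)}_min = [1, -1, 0, -399199992, 3070664268416]`, `N(Wd) = 292926150`, `∏c = 24`, `T = 1`, point by `ellrank(effort=0)`, eclib-full saturation (index 1), `ĥ = 9.273555`,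
`X = L′T²/(Ω∏c ĥ) = 1` to `0e+00` — the numerical `#Ш(Wd)_an` given rank `1`). -/

/-- `V = [1, -1, 0, -12742, 556916]` (the minimal model of `84150gr1^{(-3)}`, conductor `9350`): `Δ ≠ 0` in the kernel. [cite: Cremona2006, Table 1 (Cremona label 84150gr1)] -/
theorem isElliptic_sV84150gr1 : (⟨1, -1, 0, -12742, 556916⟩ : WeierstrassCurve ℚ).IsElliptic :=
  isElliptic_of_discOf_ne_zero 1 (-1) 0 (-12742) 556916 (by decide +kernel)

/-- `V` is globally minimal: `|Δ| = 2^6·5^8·11^2·17` kernel-checked, Kraus' criterion prime by prime. [cite: Kraus1989, Prop. 1 and Prop. 2]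
[cite: SilvermanAEC2009, VII.1 Remark 1.1] [cite: Cremona2006, Table 1 (Cremona label 84150gr1)] -/
theorem isGloballyMinimal_sV84150gr1 : (⟨1, -1, 0, -12742, 556916⟩ : WeierstrassCurve ℚ).IsGloballyMinimal :=
  isGloballyMinimal_of_krausCriterion₃_factored 1 (-1) 0 (-12742) 556916
    [(2, 6), (5, 8), (11, 2), (17, 1)] (by decide +kernel)
    (by intro qe hqe; simp only [List.mem_cons, List.not_mem_nil, or_false] at hqe
        rcases hqe with rfl | rfl | rfl | rfl <;> norm_num)
    (by set_option synthInstance.maxSize 2000 in decide +kernel)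

/-- `Wd = [1, -1, 0, -399199992, 3070664268416]` (the minimal model of the twist `84150gr1^{(-59)}`, conductor `292926150`): `Δ ≠ 0` in the kernel. [cite: Cremona2006, Table 1 (Cremona label 84150gr1)] -/
theorem isElliptic_sWd84150gr1 : (⟨1, -1, 0, -399199992, 3070664268416⟩ : WeierstrassCurve ℚ).IsElliptic :=
  isElliptic_of_discOf_ne_zero 1 (-1) 0 (-399199992) 3070664268416 (by decide +kernel)

/-- `Wd` is globally minimal: `|Δ| = 2^6·3^6·5^8·11^2·17·59^6` kernel-checked, Kraus' criterion prime by prime. [cite: Kraus1989, Prop. 1 and Prop. 2]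
[cite: SilvermanAEC2009, VII.1 Remark 1.1] [cite: Cremona2006, Table 1 (Cremona label 84150gr1)] -/
theorem isGloballyMinimal_sWd84150gr1 : (⟨1, -1, 0, -399199992, 3070664268416⟩ : WeierstrassCurve ℚ).IsGloballyMinimal :=
  isGloballyMinimal_of_krausCriterion₃_factored 1 (-1) 0 (-399199992) 3070664268416
    [(2, 6), (3, 6), (5, 8), (11, 2), (17, 1), (59, 6)] (by decide +kernel)
    (by intro qe hqe; simp only [List.mem_cons, List.not_mem_nil, or_false] at hqe
        rcases hqe with rfl | rfl | rfl | rfl | rfl | rfl <;> norm_num)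
    (by set_option synthInstance.maxSize 2000 in decide +kernel)

/-- **`84150gr1` is ADDITIVE at `3` and on the cell (G) ∧ ss, IN THE KERNEL**: `3 ∣ Δ`, `3 ∣ c₄`; `C • V^{(-3)} = E` (`[u, r, s, t] = [1, -1, 1/2, 1/2]`) with
`V` globally minimal, `3 ∤ Δ(V)`, `#Ṽ(𝔽₃) = 1` (`a₃(V) = 3`, supersingular), whence `TypeG`, `SubGord`, `SubGss` at `3` (g13's block, unchanged).
[cite: SilvermanAEC2009, VII.5 Prop. 5.1 (a), (c)] [cite: Delbourgo1998, §1.5 (G)] [cite: Cremona2006, Table 1 (Cremona label 84150gr1)] -/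
theorem subGss_three_84150gr1 {W : WeierstrassCurve ℚ} [W.IsElliptic] [W.IsGloballyMinimal] (hWeq : W = (⟨1, -1, 1, -114680, -14922053⟩ : WeierstrassCurve ℚ)) :
    Addv W 3 ∧ SubGss W 3 := by
  subst hWeq
  haveI := isElliptic_sV84150gr1
  haveI := isGloballyMinimal_sV84150gr1
  have hIW : integralModelInt (⟨1, -1, 1, -114680, -14922053⟩ : WeierstrassCurve ℚ) = (⟨1, -1, 1, -114680, -14922053⟩ : WeierstrassCurve ℤ) :=
    integralModelInt_eq_of_map_eq _ (map_mk_int 1 (-1) 1 (-114680) (-14922053))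
  have hadd : Addv (⟨1, -1, 1, -114680, -14922053⟩ : WeierstrassCurve ℚ) 3 := Additive.addv_of_intModel hIW 3 (by decide +kernel) (by decide +kernel)
  have hIV : integralModelInt (⟨1, -1, 0, -12742, 556916⟩ : WeierstrassCurve ℚ) = (⟨1, -1, 0, -12742, 556916⟩ : WeierstrassCurve ℤ) :=
    integralModelInt_eq_of_map_eq _ (map_mk_int 1 (-1) 0 (-12742) 556916)
  have hcV : Nat.card ((((⟨1, -1, 0, -12742, 556916⟩ : WeierstrassCurve ℤ)).map (Int.castRingHom (ZMod 3))).toAffine.Point) = 1 := by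
    have h := natCard_point_eq_countPoints 1 (-1) 0 (-12742) 556916 3 (by norm_num) (by decide +kernel)
    have h' : countPoints [1, -1, 0, -12742, 556916] 3 = 1 := countPoints_eq_of_fast (by decide +kernel)
    exact_mod_cast h.trans h'
  have hgood : GoodSS (⟨1, -1, 0, -12742, 556916⟩ : WeierstrassCurve ℚ) 3 := Supersingular.goodSS_of_intModel 3 hIV (by decide +kernel) hcV (by decide)
  have hVW : (⟨1, (-1 : ℚ), ((1:ℚ)/2), ((1:ℚ)/2)⟩ : VariableChange ℚ) • (⟨1, -1, 0, -12742, 556916⟩ : WeierstrassCurve ℚ).quadraticTwist (-3) =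
      (⟨1, -1, 1, -114680, -14922053⟩ : WeierstrassCurve ℚ) := by
    ext <;> simp [WeierstrassCurve.variableChange_a₁, WeierstrassCurve.variableChange_a₂,
      WeierstrassCurve.variableChange_a₃, WeierstrassCurve.variableChange_a₄, WeierstrassCurve.variableChange_a₆,
      WeierstrassCurve.quadraticTwist, WeierstrassCurve.b₂, WeierstrassCurve.b₄, WeierstrassCurve.b₆] <;> norm_num
  obtain ⟨C, hC⟩ := exists_variableChange_quadraticTwist_symm (⟨1, -1, 1, -114680, -14922053⟩ : WeierstrassCurve ℚ)
    (⟨1, -1, 0, -12742, 556916⟩ : WeierstrassCurve ℚ) (d := (-3 : ℚ)) (by norm_num) ⟨_, hVW⟩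
  have hC' : C • (⟨1, -1, 1, -114680, -14922053⟩ : WeierstrassCurve ℚ).quadraticTwist ((-1 : ℚ) ^ ((3 : ℕ) / 2) * (3 : ℕ)) =
      (⟨1, -1, 0, -12742, 556916⟩ : WeierstrassCurve ℚ) := by
    rw [O5.pstar_three]; exact hC
  have hG : TypeG (⟨1, -1, 1, -114680, -14922053⟩ : WeierstrassCurve ℚ) 3 := (typeG_three_iff_good_twist _ hadd _ C hC').mpr hgood.1
  exact ⟨hadd, (O5.subGss_three_iff_subGord_and_goodSS_twist _ hadd _ C hC).mpr
    ⟨subGord_three_of_typeG_of_addv _ hG hadd, hgood⟩⟩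

/-- `Δ(E₀) = -37488825000000 = -2^6·3^6·5^8·11^2·17` on the integer equation of `84150gr1`. [cite: Cremona2006, Table 1 (Cremona label 84150gr1)] -/
theorem Δ_eq_84150gr1 : (⟨1, -1, 1, -114680, -14922053⟩ : WeierstrassCurve ℤ).Δ = -37488825000000 := by
  norm_num [WeierstrassCurve.Δ, WeierstrassCurve.b₂, WeierstrassCurve.b₄, WeierstrassCurve.b₆, WeierstrassCurve.b₈]

/-- `c₄(E₀) = 5504625` on the integer equation of `84150gr1`. [cite: Cremona2006, Table 1 (Cremona label 84150gr1)] -/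
theorem c₄_eq_84150gr1 : (⟨1, -1, 1, -114680, -14922053⟩ : WeierstrassCurve ℤ).c₄ = 5504625 := by
  norm_num [WeierstrassCurve.c₄, WeierstrassCurve.b₂, WeierstrassCurve.b₄]

/-- The Kraus list of `84150gr1` consists of primes and multiplies to `|Δ(E₀)|`, IN THE KERNEL: a prime dividing `Δ_min` is one of `[2, 3, 5, 11, 17]`. [cite: Cremona2006, Table 1 (Cremona label 84150gr1)] -/
theorem krausList_84150gr1 : (∀ qe ∈ ([(2, 6), (3, 6), (5, 8), (11, 2), (17, 1)] : List (ℕ × ℕ)), qe.1.Prime) ∧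
    (([(2, 6), (3, 6), (5, 8), (11, 2), (17, 1)] : List (ℕ × ℕ)).map fun qe => qe.1 ^ qe.2).prod = (-37488825000000 : ℤ).natAbs :=
  ⟨by decide +kernel, by decide +kernel⟩

/-- **`ρ̄_{E,3}` ONTO for `84150gr1`, IN THE KERNEL** (Frobenius-order witness `hasSurjectiveModNGaloisRep_of_intModel_of_irr_of_order`): at the good prime `ℓ₁ = 23` (`#Ẽ(𝔽_{23}) = 32`,
`a = -8`) `X² − aX + 23` is irreducible mod `3`; at `ℓ₂ = 7 ≡ 1 (mod 3)` (`#Ẽ = 3`, `a = 5 ≡ 2`, `9 ∤ 3`) an element of order `3`; point counts by `countPoints_eq_of_fast`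
(Sage's `is_surjective(3)` agrees). [cite: Serre1972, §2.8 Prop. 19] [cite: Zywina2015, §1] [cite: Cremona2006, Table 1 (Cremona label 84150gr1)] -/
theorem surj_three_84150gr1 {W : WeierstrassCurve ℚ} [W.IsElliptic] [W.IsGloballyMinimal] (hWeq : W = (⟨1, -1, 1, -114680, -14922053⟩ : WeierstrassCurve ℚ)) : Surj W 3 := by
  subst hWeq
  haveI : Fact (Nat.Prime 23) := ⟨by norm_num⟩
  haveI : Fact (Nat.Prime 7) := ⟨by norm_num⟩
  have hI : integralModelInt (⟨1, -1, 1, -114680, -14922053⟩ : WeierstrassCurve ℚ) = (⟨1, -1, 1, -114680, -14922053⟩ : WeierstrassCurve ℤ) :=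
    integralModelInt_eq_of_map_eq _ (map_mk_int 1 (-1) 1 (-114680) (-14922053))
  have hc₁ : Nat.card ((((⟨1, -1, 1, -114680, -14922053⟩ : WeierstrassCurve ℤ)).map (Int.castRingHom (ZMod 23))).toAffine.Point) = 32 := by
    exact_mod_cast (natCard_point_eq_countPoints 1 (-1) 1 (-114680) (-14922053) 23 (by norm_num) (by decide +kernel)).trans (countPoints_eq_of_fast (n := 32) (by decide +kernel))
  have hc₂ : Nat.card ((((⟨1, -1, 1, -114680, -14922053⟩ : WeierstrassCurve ℤ)).map (Int.castRingHom (ZMod 7))).toAffine.Point) = 3 := by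
    exact_mod_cast (natCard_point_eq_countPoints 1 (-1) 1 (-114680) (-14922053) 7 (by norm_num) (by decide +kernel)).trans (countPoints_eq_of_fast (n := 3) (by decide +kernel))
  exact hasSurjectiveModNGaloisRep_of_intModel_of_irr_of_order hI 3 23 7 (by norm_num) (by norm_num) (by rw [Δ_eq_84150gr1]; norm_num)
    (by rw [Δ_eq_84150gr1]; norm_num) hc₁ hc₂ (by decide) (by decide) (by decide) (by decide)

/-- **U₀ AT `84150gr1` ON ITS SAVING ROW (inert-set Shimura-curve road, TU₀|saving)** — `MissingUpperBoundAt W 3` at `W = E` (`r_an = 0`) from rhp-p2 g11's shape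
p674548 `leafRankZeroUpper_three_of_shimuraInertDatum_at_saving_of_twistUnitZero` through the door `leafRankZeroUpper_three_at_saving_of_sqrtField`.  PRINTED: `hGZK hmod hnf hJL hCO hPrim`.  KERNEL: `Addv ∧ SubGss` at `3`; `ρ̄₃` onto;
`q₁ = 5 ∣ Δ_min`; `11`, `2` multiplicative; every prime of `Δ_min` enumerated (`krausList_84150gr1`) for `hFC` and for `hshape` off `q₁` (`c = 1` off `Δ_min`, Kodaira–Néron at multiplicative
primes, Tate certificates at the additive primes `[3]`); (DEG) très ramifié at `s₁ = 11`; the congruences making `11`, `2` inert and the other `ℓ ∣ N` split in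
`ℚ(√-59)`; `Cd • E^{(-59)} = Wd`, `Cd = [1, -15, 1/2, 0]`, `Wd` Kraus-minimal.  DISPLAYED: `hN`, `hr` (`r_an = 0`), `Dt`/`hc`, `hLt0`/`hLt1` (`L(E^{(-59)},1) = 0 ≠ L′`; census: root no. `−1`,
`L′(Wd,1) ≈ 18.31486`), `hqd`/`hvd` (`#Ш(Wd)_an = 1`; census: `X = L′T²/(Ω∏c ĥ) = 1` to `0e+00`, eclib-full-saturated point of height `9.2736` by `ellrank(effort=0)`, 2-descent rank `1`).
NO S2 / Σ / L₀ / L₁.  Per curve; U₀ (26024) stays OPEN class-wide; BSD is NOT proved by this.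
[cite: JetchevSkinnerWan2017, §7.4.2 (p. 31)] [cite: PastenShimura2024, Prop. 6.13, Lemma 6.15, Lemma 6.18] [cite: SilvermanAEC2009, VII.5 Prop. 5.1] [cite: Cremona2006, Table 1 (Cremona label 84150gr1)] -/
theorem u0s_at_84150gr1
    (hGZK : rank_eq_analyticRank_of_analyticRank_le_one) (hmod : hasEntireLFunction_rat)
    (hnf : exists_isNewformOf) (hJL : nonempty_shimuraParametrizationData)
    (hCO : PastenShimura2024_componentOrders) (hPrim : shimuraCurve_heegnerSystem_primitivesAtThree)
    {W : WeierstrassCurve ℚ} [W.IsElliptic] [W.IsGloballyMinimal] (hWeq : W = (⟨1, -1, 1, -114680, -14922053⟩ : WeierstrassCurve ℚ))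
    (hN : W.conductorNorm ℤ = 84150) [NeZero (W.conductorNorm ℤ)] (hr : W.analyticRank = 0)
    (Dt : ModularParametrizationData W (W.conductorNorm ℤ)) (hc : ¬ (3 : ℤ) ∣ Dt.c)
    (hLt0 : (W.quadraticTwist (((-59 : ℤ) : ℚ))).entireLFunction 1 = 0) (hLt1 : deriv (W.quadraticTwist (((-59 : ℤ) : ℚ))).entireLFunction 1 ≠ 0)
    {qd : ℚ} (hqd : haveI := isElliptic_sWd84150gr1; shaAn (⟨1, -1, 0, -399199992, 3070664268416⟩ : WeierstrassCurve ℚ) = (qd : ℂ))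
    (hvd : padicValRat 3 qd ≤ 0) :
    MissingUpperBoundAt W 3 := by
  subst hWeq
  haveI := isElliptic_sWd84150gr1; haveI := isGloballyMinimal_sWd84150gr1
  have hI : integralModelInt (⟨1, -1, 1, -114680, -14922053⟩ : WeierstrassCurve ℚ) = (⟨1, -1, 1, -114680, -14922053⟩ : WeierstrassCurve ℤ) :=
    integralModelInt_eq_of_map_eq _ (map_mk_int 1 (-1) 1 (-114680) (-14922053))
  have hGS := subGss_three_84150gr1 (W := (⟨1, -1, 1, -114680, -14922053⟩ : WeierstrassCurve ℚ)) rfl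
  have hsurj := surj_three_84150gr1 (W := (⟨1, -1, 1, -114680, -14922053⟩ : WeierstrassCurve ℚ)) rfl
  haveI : Fact ((-59 : ℤ) < 0) := ⟨by norm_num⟩; haveI : Fact (Nat.Prime 5) := ⟨by norm_num⟩
  haveI : Fact (Nat.Prime 11) := ⟨by norm_num⟩; haveI : Fact (Nat.Prime 2) := ⟨by norm_num⟩
  have hbad₁ := WeierstrassCurve.not_hasGoodReductionAtPrime_of_dvd_minimalDiscriminantInt (⟨1, -1, 1, -114680, -14922053⟩ : WeierstrassCurve ℚ) 5 (by rw [IntModel.minimalDiscriminantInt_eq hI, Δ_eq_84150gr1]; norm_num)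
  have hm₁ : (⟨1, -1, 1, -114680, -14922053⟩ : WeierstrassCurve ℚ).HasMultiplicativeReductionAtPrime 11 := IntModel.hasMultiplicativeReductionAtPrime_of_intModel hI 11 (by rw [Δ_eq_84150gr1]; norm_num) (by rw [c₄_eq_84150gr1]; norm_num)
  have hm₂ : (⟨1, -1, 1, -114680, -14922053⟩ : WeierstrassCurve ℚ).HasMultiplicativeReductionAtPrime 2 := IntModel.hasMultiplicativeReductionAtPrime_of_intModel hI 2 (by rw [Δ_eq_84150gr1]; norm_num) (by rw [c₄_eq_84150gr1]; norm_num)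
  have hFC : ∀ (ℓ : ℕ) [Fact ℓ.Prime], ℓ ≠ 11 → ℓ ≠ 2 → ℓ ≠ 5 → (⟨1, -1, 1, -114680, -14922053⟩ : WeierstrassCurve ℚ).HasSplitMultiplicativeReductionAtPrime ℓ →
      ¬ 3 ∣ padicValInt ℓ (⟨1, -1, 1, -114680, -14922053⟩ : WeierstrassCurve ℚ).minimalDiscriminantInt := by
    intro ℓ hℓF hne₁ hne₂ hneq hs
    have hd := dvd_minimalDiscriminantInt_of_mult _ ℓ hs.hasMultiplicativeReductionAtPrime
    rw [IntModel.minimalDiscriminantInt_eq hI, Δ_eq_84150gr1] at hd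
    have hmem := mem_of_prime_dvd_of_prodPow_eq _ krausList_84150gr1 hℓF.out hd
    simp only [List.map_cons, List.map_nil, List.mem_cons, List.not_mem_nil, or_false] at hmem
    rcases hmem with rfl | rfl | rfl | rfl | rfl
    · exact absurd rfl hne₂
    · exact absurd hs.hasMultiplicativeReductionAtPrime (X9.PrintCert.not_hasMultiplicativeReductionAtPrime_of_dvd_of_dvd hI 3 (by rw [Δ_eq_84150gr1]; norm_num) (by rw [c₄_eq_84150gr1]; norm_num))
    · exact absurd rfl hneq
    · exact absurd rfl hne₁
    · rw [IntModel.minimalDiscriminantInt_eq hI, Δ_eq_84150gr1, IntModel.padicValInt_eq_of_dvd_of_not_dvd 17 (e := 1) (by norm_num) (by norm_num)]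
      decide
  have hshape : ∀ (q : ℕ) [Fact q.Prime], q ≠ 5 → 3 ∣ ((⟨1, -1, 1, -114680, -14922053⟩ : WeierstrassCurve ℚ).baseChange ℚ_[q]).localTamagawaNumber ℤ_[q] →
      (⟨1, -1, 1, -114680, -14922053⟩ : WeierstrassCurve ℚ).HasSplitMultiplicativeReductionAtPrime q := by
    intro q hqF hq h3
    by_cases hd : (q : ℤ) ∣ minimalDiscriminantInt (⟨1, -1, 1, -114680, -14922053⟩ : WeierstrassCurve ℚ)
    swap
    · exact absurd h3 (not_three_dvd_localTamagawaNumber_of_not_dvd _ q hd)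
    rw [IntModel.minimalDiscriminantInt_eq hI, Δ_eq_84150gr1] at hd
    have hmem := mem_of_prime_dvd_of_prodPow_eq _ krausList_84150gr1 hqF.out hd
    simp only [List.map_cons, List.map_nil, List.mem_cons, List.not_mem_nil, or_false] at hmem
    rcases hmem with rfl | rfl | rfl | rfl | rfl
    · exact (Koly.split_and_three_dvd_of_mult_of_three_dvd_localTamagawaNumber _ 2 (IntModel.hasMultiplicativeReductionAtPrime_of_intModel hI 2 (by rw [Δ_eq_84150gr1]; norm_num) (by rw [c₄_eq_84150gr1]; norm_num)) h3).1
    · have hc3 : ((⟨1, -1, 1, -114680, -14922053⟩ : WeierstrassCurve ℚ).baseChange ℚ_[3]).localTamagawaNumber ℤ_[3] = 1 := -- additive `3` (I0*): Tate certificate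
        (IntModelTam.localTamagawaNumber_padic_eq_of_intModel_of_tamZ hI 3 (F := ⟨3, 9, 1, 1, 8, 6, 0, 0⟩) rfl (by decide +kernel)).trans (by decide)
      rw [hc3] at h3; exact absurd h3 (by decide)
    · exact absurd rfl hq
    · exact (Koly.split_and_three_dvd_of_mult_of_three_dvd_localTamagawaNumber _ 11 (IntModel.hasMultiplicativeReductionAtPrime_of_intModel hI 11 (by rw [Δ_eq_84150gr1]; norm_num) (by rw [c₄_eq_84150gr1]; norm_num)) h3).1
    · exact (Koly.split_and_three_dvd_of_mult_of_three_dvd_localTamagawaNumber _ 17 (IntModel.hasMultiplicativeReductionAtPrime_of_intModel hI 17 (by rw [Δ_eq_84150gr1]; norm_num) (by rw [c₄_eq_84150gr1]; norm_num)) h3).1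
  have hjac : ∀ ℓ : ℕ, ℓ.Prime → ℓ ∣ (⟨1, -1, 1, -114680, -14922053⟩ : WeierstrassCurve ℚ).conductorNorm ℤ → ℓ ≠ 11 → ℓ ≠ 2 → ℓ ≠ 2 →
      jacobiSym (-59) ℓ = 1 := by
    intro ℓ hℓ hℓN hne₁ hne₂ hℓ2
    rw [hN] at hℓN
    have hmem : ℓ ∈ Nat.primeFactors 84150 := Nat.mem_primeFactors.mpr ⟨hℓ, hℓN, by norm_num⟩
    rw [show Nat.primeFactors 84150 = {2, 3, 5, 11, 17} by decide +kernel] at hmem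
    simp only [Finset.mem_insert, Finset.mem_singleton] at hmem
    rcases hmem with rfl | rfl | rfl | rfl | rfl
    · exact absurd rfl hne₂
    · norm_num [jacobiSym.mod_left]
    · norm_num [jacobiSym.mod_left]
    · exact absurd rfl hne₁
    · norm_num [jacobiSym.mod_left]
  have hWd : (⟨1, (-15 : ℚ), ((1:ℚ)/2), (0 : ℚ)⟩ : VariableChange ℚ) • (⟨1, -1, 1, -114680, -14922053⟩ : WeierstrassCurve ℚ).quadraticTwist (((-59 : ℤ) : ℚ)) =
      (⟨1, -1, 0, -399199992, 3070664268416⟩ : WeierstrassCurve ℚ) := by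
    push_cast; ext <;> simp [WeierstrassCurve.variableChange_a₁, WeierstrassCurve.variableChange_a₂,
      WeierstrassCurve.variableChange_a₃, WeierstrassCurve.variableChange_a₄, WeierstrassCurve.variableChange_a₆,
      WeierstrassCurve.quadraticTwist, WeierstrassCurve.b₂, WeierstrassCurve.b₄, WeierstrassCurve.b₆] <;> norm_num
  exact leafRankZeroUpper_three_at_saving_of_sqrtField hGZK hmod hnf hJL hCO hPrim _ hGS.1 hGS.2 hr hsurj rfl Dt hc 5 hbad₁
    (s₁ := 11) (s₂ := 2) (by decide) (by decide) (by decide) hm₁ hm₂ hFC hshape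
    (Or.inl (by rw [IntModel.minimalDiscriminantInt_eq hI, Δ_eq_84150gr1, IntModel.padicValInt_eq_of_dvd_of_not_dvd 11 (e := 2) (by norm_num) (by norm_num)]; decide))
    (-59) (by norm_num) (by rw [show (-59 : ℤ).natAbs = 59 by rfl, Nat.squarefree_iff_nodup_primeFactorsList (by norm_num)]; simp)
    (Or.inr ⟨by decide, by norm_num [jacobiSym.mod_left]⟩) (by norm_num) (Or.inl ⟨rfl, by norm_num⟩) (by norm_num) hjac
    (fun _ _ h ↦ absurd rfl h) hLt0 hLt1 _ _ hWd hqd hvd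

end Summit.BirchSwinnertonDyer.BirchSwinnertonDyer.Theorems.RamifiedHeegnerPairTwistUnitSaving

end
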